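import Literature.NumberTheory.EllipticCurves.BDPAnticyclotomicPAdicLFunction
import HarnessLib

/-!
# The anticyclotomic `p`-adic `L`-function of a newform of HIGHER WEIGHT `k`: the twisted values
# `L(g/K, φ, k/2)`, the interpolation value of Castella–Hsieh (Prop. 3.8) in Castella's
# normalisation, and the characterising predicate `IsBDPLFunctionWt` (weight-`k` twin of `IsBDPLFunction`)

Trunk T-NT-EC (`Literature/NumberTheory/EllipticCurves`). Definition request `defn-IsBDPLFunctionWeightK`
(cell `bsd-stepL`, planner g27, item D3 of `SPEC-19270-RoadFF-objects-imc-p1-g6.md` = evidence #12 on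
`stmt-BirchSwinnertonDyer-19270`; sources collected VERBATIM in the cell's `LIT-DOSSIER §20.9 / §20.4`
= evidence #19, `ROADFF-SOURCE-PACK-lit-g14.md`). The tree's weight-`2` frame
`IsBDPLFunction ι 𝔭 κ γ f ΩK Ωp L` (`BDPAnticyclotomicPAdicLFunction.lean` §4: Castella 2018, Thm. 3.1, for
`f ∈ S₂(Γ₀(N))`) is generalised to a cusp form `g ∈ S_k(Γ₀(M))` of ANY weight `k` (meant: `k = 2r ≥ 2`
even, `g` a `p`-ordinary newform with `p ∤ M` — the crystalline members `g_m` of weight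
`k_m ≡ 2 (mod p − 1)` of the Hida family through `f_E` that Castella's erratum uses), keeping every
convention of the weight-`2` frame and changing exactly the three places where the weight enters the
printed interpolation formula of Castella–Hsieh 2018, Prop. 3.8 (published numbering; = arXiv Prop. 3.6):

* the Euler factors of `L(g/K, φ, s)`: `α_ℓ β_ℓ = ℓ^{k-1}` for `ℓ ∤ M` (weight `2`: `ℓ`), absolute
  convergence for `re s > (k+1)/2` (weight `2`: `3/2`), and the CENTRAL point `s = k/2` (weight `2`:
  `s = 1`; Castella 2020, Rem. 2.12: "the `L`-values appearing in Theorem 2.11 are central critical values");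
* the Gamma factors `Γ(n − k/2 + 1) Γ(n + k/2)` (Castella–Hsieh: `Γ(2r + m) Γ(m + 1)` at infinity type
  `(r + m, −r − m)`, `n = r + m`; weight `2`: `Γ(n) Γ(n+1)`);
* the `p`-adic multiplier `(1 − a_p(g) p^{−k/2} φ(𝔭) + ε_p φ(𝔭)²)²` (Castella–Hsieh:
  `e_𝔭(f, χ) = (1 − a_p(f) p^{−r} χ_𝔭̄(p) + χ_𝔭̄(p²) p^{−1})²` for `p ∤ c`; weight `2`: `p^{−1}` in place of
  `p^{−r}`),

and the RANGE of interpolation `n ≥ k/2` (Castella–Hsieh: `m ≥ 0`; weight `2`: `n > 0`). At `k = 2`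
every object of this file is PROVABLY EQUAL to its weight-`2` original (`…_two`, `isBDPLFunctionWt_two_iff`):
the generalisation reduces to the tree's frame, as the request demands. Everything here is a DEFINITION with
a body plus proved API; no named fact, no `sorry` (the existence statements — Castella–Hsieh Def. 3.7 /
Prop. 3.8 at weight `2r`, Castella 2020 Thm. 2.11 for the two-variable family — are for the fact files F3/F4
of the SPEC, not for this file).

## The printed statements (verbatim, from the cell's source pack; author-PDF page numbers)

**Castella–Hsieh, Math. Ann. 370 (2018), §3.3, p. 11 (definitions) and p. 13 (Def. 3.7, Prop. 3.8).**
"If `χ` has infinity type `(r+m, −r−m)` with `m ≥ 0`, define the algebraic central value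
`L^alg(1/2, π_K ⊗ χ) = Γ(2r+m)Γ(m+1) / ((4π)^{2r+2m+1} (Im ϑ)^{2r+2m}) · L(1/2, π_K ⊗ χ) / Ω_K^{4(r+m)}`,
and the `p`-adic multiplier `e_𝔭(f, χ)` by `e_𝔭(f, χ) = (1 − a_p(f) p^{−r} χ_𝔭̄(p) + χ_𝔭̄(p²) p^{−1})²` if
`p ∤ c`; `ε(1/2, χ_𝔭)^{−2}` if `p ∣ c`." (`f ∈ S^new_{2r}(Γ₀(N))`, Hyp. (H)(a): `p ∤ 2(2r−1)! N φ(N)`.)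
"**Definition 3.7.** Let `ψ` be an anticyclotomic Hecke character of infinity type `(r, −r)` … Define the
`p`-adic measure `ℒ_{𝔭,ψ}(f)` on `Γ̃` by … We shall also view `ℒ_{𝔭,ψ}(f)` as an element in the semi-local
ring `𝒲⟦Γ̃⟧`." "**Proposition 3.8.** If `φ̂ ∈ 𝔛_{p^∞}` is the `p`-adic avatar of a Hecke character `φ` of
infinity type `(m, −m)` with `m ≥ 0` and `p`-power conductor, then
`(ℒ_{𝔭,ψ}(f)(φ̂) / Ω_p^{2r+2m})² = L^alg(1/2, π_K ⊗ ψφ) · e_𝔭(f, ψφ) · φ(𝔑^{−1}) · 2^{#A(ψ)+3} c_o ε(f) · u_K² √D_K`."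
(CM periods `(Ω_K, Ω_p) ∈ ℂ^× × 𝒲^×`, §2.5, p. 7; `𝒲` = ring of integers of `ℚ̂_p^ur` = the tree's
`unrIntegers p`.)

**Castella, Camb. J. Math. 6 (2018), Thm. 3.1 and its proof, pp. 8–9** (the weight-`2` case, the tree's
`IsBDPLFunction`): "`L_p(f, φ̂) = Γ(n)Γ(n+1) · (1 − a_p p^{−1} φ(𝔭̄) + ε_p φ²(𝔭̄))² · Ω_p^{4n} · L(f/K, φ, 1)
/ (π^{2n+1} · Ω_K^{4n})`" for "`φ̂` the `p`-adic avatar of an unramified anticyclotomic Hecke character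
`φ` with infinity type `(−n, n)` with `n > 0`", where "`L_p(f) := Tw_{ψ^{−1}}(ℒ_{𝔭,ψ}(f))` … If
`p ∤ N`, the interpolation property for `L_p(f)` is a reformulation of [CH17, Thm. 3.8]" — i.e. Thm. 3.1 is
Prop. 3.8 with `r = 1`, `χ = ψφ` of infinity type `(1 + m, −1 − m) = (n, −n)`, the square root taken on
both sides, and the constants that are `p`-adic units for `p` odd (`4^{2n+1}`, `(Im ϑ)^{2n}`,
`2^{#A(ψ)+3} c_o ε(f) u_K² √D_K`, and the Iwasawa unit `φ ↦ φ(𝔑^{−1})`) absorbed into the periods / a unit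
of `Λ_{R₀}`. THE PRESENT FILE APPLIES THE SAME REFORMULATION AT WEIGHT `2r = k`: `χ = ψφ` with `ψ` of
infinity type `(r, −r)` (Castella 2020, proof of Thm. 2.11: "`ξ_ν` is the `p`-adic avatar of an
anticyclotomic Hecke character of infinity type `(k/2, −k/2)` … `ν(ℒ_{𝔭,ξ}(𝐟))` agrees with the
`𝒲`-valued measure `ℒ_{𝔭,ξ_ν}(f)` on `Γ̃` constructed in [CH18, §3.3]"), so that `n = r + m ≥ r = k/2`,
`Γ(2r+m)Γ(m+1) = Γ(n + k/2) Γ(n − k/2 + 1)`, `Ω_p^{2(2r+2m)} = Ω_p^{4n}`, `Ω_K^{4(r+m)} = Ω_K^{4n}`,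
`(4π)^{2r+2m+1} ↦ π^{2n+1}`, and `e_𝔭 = (1 − a_p p^{−k/2} χ_𝔭̄(p) + χ_𝔭̄(p²) p^{−1})²`.

**Castella, J. Inst. Math. Jussieu 19 (2020), Thm. 2.11, p. 12** (the two-variable parent, for the record):
"Let `ν ∈ 𝒳_𝒪(𝕀)` of weight `(k, 𝟙)` with `k ≥ 1` be such that `𝐟_ν` is classical, and let `φ̂` be the
`p`-adic avatar of an anticyclotomic Hecke character `φ` of `K` of infinity type `(ℓ, −ℓ)` with `ℓ ≥ 0` and
conductor `c_o p^n 𝒪_K` with `p ∤ c_o`. Then: `ν(ℒ_{𝔭,ξ}(𝐟))(φ̂)² / Ω_p^{2k+4ℓ} = L^alg(f_ν/K, χ_νξ_νφ, k_ν − 1) ·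
𝓔_𝔭(f_ν, χ_νξ_νφ)² · φ(𝔑^{−1}) · 2³ · c_o ε(f_ν) · w_K² √D_K`", with "`L^alg(f_ν/K, χ, k_ν − 1) :=
Γ(k_ν+ℓ)Γ(ℓ+1) / ((2π)^{k_ν+2ℓ+1} (Im ϑ)^{k_ν+2ℓ}) · L(f_ν/K, χ, k_ν − 1) / Ω_K^{2k_ν+4ℓ}`" and (Rem. 2.12)
"`L(f_ν/K, χ_νξ_νφ, k_ν − 1) = L(f_ν/K, ξ_νφ, k_ν/2)`, and so the `L`-values appearing in Theorem 2.11 are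
central critical values."

## Conventions (all inherited from the weight-`2` file; see its module docstring)

Infinity types are read through Mathlib's embedding of the infinite place of `K`: Castella's "infinity type
`(−n, n)`" is the tree's `HeckeCharacter.HasInfinityType (fun _ ↦ n) (fun _ ↦ −n)`; `φ(𝔭)` is
`heckeValueExtZero φ 𝔭` at the distinguished prime `𝔭 ∣ p` (a PARAMETER; meant: the prime induced by
`ι⁻¹`; the source pack records that the printed multiplier carries `𝔭̄` where the arXiv text layer of
Castella 2018 shows `𝔭` — the weight-`2` frame's reading is kept unchanged here, so that a congruence
between a weight-`2` and a weight-`k` frame (SPEC F3) compares like with like); `ε_p = p^{−1}` if `p ∤ M`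
and `0` otherwise (only `p ∤ M` is printed at weight `k > 2`: Castella–Hsieh Hyp. (H)(a)); the receptacle is
`UnrSeries p = R₀⟦T⟧` with `1 + T ↔ γ`; values are transported along `ι⁻¹ : ℂ → ℚ̄_p ⊂ ℂ_p`.
`k/2` is INTEGER division (`k / 2 : ℤ`): for the printed even weights `k = 2r` it is `r`; for odd `k` the
objects below are not printed objects (Castella–Hsieh work in weight `2r`).

## Contents

* §1 `rankinSelbergLocalFactorInvHeckeWt`, `rankinSelbergEulerProductHeckeWt`, `IsRankinSelbergValueHeckeWt`,
  `rankinSelbergValueHeckeWt` — `L(g/K, φ, s)` for `g ∈ S_k(Γ₀(M))` (verbatim the weight-`2` §1 with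
  `α_ℓβ_ℓ = ℓ^{k−1}` and the half-plane `re s > (k+1)/2`), the API of the weight-`2` file, and the bridges
  `…_two` (equal to the weight-`2` objects on `S₂(Γ₀(N))`).
* §2 `bdpInterpolationValueWt p g 𝔭 φ n ΩK` — the complex part of the interpolation value — and
  `bdpInterpolationValueWt_two`.
* §3 **`IsBDPLFunctionWt ι 𝔭 κ γ g ΩK Ωp L`** — the characterising predicate — its API, and
  `isBDPLFunctionWt_two_iff : IsBDPLFunctionWt ι 𝔭 κ γ f ΩK Ωp L ↔ IsBDPLFunction ι 𝔭 κ γ f ΩK Ωp L` for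
  `f ∈ S₂(Γ₀(N))`.

HONEST SCOPE: a characterising PREDICATE (frame) and the special values it mentions; no construction of
`ℒ_{𝔭,ψ}(g)`, no existence claim, nothing about Hida families; the weight-`k` display is Castella–Hsieh's
Prop. 3.8 put in the normalisation of Castella 2018 Thm. 3.1 exactly as that theorem does at weight `2`
(documented above line by line) — it is not a verbatim display of either paper for `k > 2`. For RoadFF only
the IDEAL `(L) ⊂ Λ^{ur}` generated by a frame matters (SPEC §2 (iv)), which is insensitive to the
`p`-adic-unit constants suppressed by this normalisation.

## References

* [CastellaHsieh2018] F. Castella, M.-L. Hsieh, *Heegner cycles and `p`-adic `L`-functions*, Math. Ann.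
  370 (2018) 567–628: Hyp. (H) p. 1–2, §2.5 p. 7 (CM periods), §3.3 pp. 10–13 (`L^alg`, `e_𝔭`, Def. 3.7,
  Prop. 3.8; arXiv:1505.08165 numbering Def. 3.5 / Prop. 3.6).
* [Castella2018] F. Castella, *On the `p`-part of the Birch–Swinnerton-Dyer formula for multiplicative
  primes*, Camb. J. Math. 6 (2018): Thm. 3.1 and proof pp. 8–9; (4.1) and p. 11 (specialisation of the
  two-variable `L_p(𝐟)`).
* [Castella2020JIMJ] F. Castella, *On the `p`-adic variation of Heegner points*, J. Inst. Math. Jussieu 19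
  (2020) 2127–2164: Def. 2.10 p. 11, Thm. 2.11 / Rem. 2.12 / Cor. 2.13 p. 12.
* [BertoliniDarmonPrasanna2013] M. Bertolini, H. Darmon, K. Prasanna, Duke Math. J. 162 (2013), §5
  (the original `p`-adic Rankin `L`-series in weight `k`).
* [Nekovar1995] J. Nekovář, Math. Ann. 302 (1995), (0.5) and §3.4 (the Euler product `L(f ⊗ K, 𝒲, s)`).
-/

noncomputable section

open scoped MatrixGroups ModularForm Topology
open CongruenceSubgroup NumberField IsDedekindDomain Field Polynomial
open Literature.NumberTheory.GaloisRepresentations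
open Literature.NumberTheory.EllipticCurves.ModularForms

universe u

namespace Literature.NumberTheory.EllipticCurves

/-! ### §1. `L(g/K, φ, s)` for a cusp form of weight `k` and an idelic Hecke character `φ` -/

section RankinSelbergHeckeWt

variable {K : Type u} [Field K] [NumberField K] {M N : ℕ} {k : ℤ}

/-- **The inverse local factor of `L(g/K, φ, s)` at the finite prime `v` of `K`** for
`g ∈ S_k(Γ₀(M))` and an idelic Hecke character `φ` of `K` (any infinity type): with `N(v) = ℓ^d`,
`w = φ(ϖ_v)` (extended by zero) and `X = N(v)^{-s}`,
`(1 - α_ℓ^d w X)(1 - β_ℓ^d w X) = 1 - (α_ℓ^d + β_ℓ^d) w X + (α_ℓ β_ℓ)^d w² X²`, where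
`α_ℓ + β_ℓ = a_ℓ(g)` (`cuspCoeff g ℓ`) and `α_ℓ β_ℓ = ℓ^{k-1} · 𝟙_{ℓ ∤ M}` (Hecke polynomial
`X² − a_ℓ X + ℓ^{k−1}` in weight `k`, trivial character; `α_ℓ β_ℓ = 0` at the level). Verbatim the
weight-`2` `rankinSelbergLocalFactorInvHecke` with `ℓ ↦ ℓ^{k−1}`. [cite: Nekovar1995, (0.5) p. 611 and §3.4]
[cite: CastellaHsieh2018, §3.3 (`L(s, π_K ⊗ χ)`)] -/
def rankinSelbergLocalFactorInvHeckeWt (g : CuspForm (Gamma0 M) k) (φ : HeckeCharacter K)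
    (v : HeightOneSpectrum (𝓞 K)) (s : ℂ) : ℂ :=
  let q : ℕ := Ideal.absNorm v.asIdeal
  let ℓ : ℕ := q.minFac
  let d : ℕ := q.factorization ℓ
  let e : ℂ := if ℓ ∣ M then 0 else (ℓ : ℂ) ^ (k - 1)
  let w : ℂ := heckeValueExtZero φ v
  1 - frobTracePow (cuspCoeff g ℓ) e d * w * (q : ℂ) ^ (-s) + e ^ d * w ^ 2 * (q : ℂ) ^ (-2 * s)

/-- **`L(g/K, φ, s)` as an Euler product** over the finite primes of `K` (a `tprod`; for unitary `φ`
absolutely convergent for `re s > (k+1)/2` by Deligne's bound `|α_ℓ| = |β_ℓ| = ℓ^{(k−1)/2}`; junk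
elsewhere, the continuation being handled by `IsRankinSelbergValueHeckeWt`). Castella–Hsieh's
`L(s, π_K ⊗ χ)` is this in the unitary normalisation (their central value `L(1/2, π_K ⊗ χ)` is the value
at `s = k/2` here; Castella 2020, Rem. 2.12). [cite: CastellaHsieh2018, §3.3] [cite: Nekovar1995, §3.4] -/
def rankinSelbergEulerProductHeckeWt (g : CuspForm (Gamma0 M) k) (φ : HeckeCharacter K) (s : ℂ) : ℂ :=
  ∏' v : HeightOneSpectrum (𝓞 K), (rankinSelbergLocalFactorInvHeckeWt g φ v s)⁻¹

/-- **`L₀` is the value at `s₀` of (the analytic continuation of) `L(g/K, φ, s)`**: every entire function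
agreeing with the Euler product for `re s > (k+1)/2` takes the value `L₀` at `s₀` (pattern of
`IsRankinSelbergValueHecke`, whose half-plane `re s > 3/2` is the case `k = 2`). [cite: Nekovar1995, §1.6–1.7] -/
def IsRankinSelbergValueHeckeWt (g : CuspForm (Gamma0 M) k) (φ : HeckeCharacter K) (s₀ L₀ : ℂ) : Prop :=
  ∀ L : ℂ → ℂ, Differentiable ℂ L →
    (∀ s : ℂ, ((k : ℝ) + 1) / 2 < s.re → L s = rankinSelbergEulerProductHeckeWt g φ s) → L s₀ = L₀

open scoped Classical in
/-- **The special value `L(g/K, φ, s₀)`** through the continuation: the unique `L₀` with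
`IsRankinSelbergValueHeckeWt g φ s₀ L₀`, junk `0` if not unique. The interpolation formulas use the
CENTRAL value `s₀ = k/2` (Castella 2020, Rem. 2.12; weight `2`: Castella 2018, Thm. 3.1, `L(f/K, φ, 1)`).
[cite: Castella2020JIMJ, Rem. 2.12] -/
def rankinSelbergValueHeckeWt (g : CuspForm (Gamma0 M) k) (φ : HeckeCharacter K) (s₀ : ℂ) : ℂ :=
  if h : ∃! L₀ : ℂ, IsRankinSelbergValueHeckeWt g φ s₀ L₀ then h.choose else 0

/-! #### API -/

/-- Defining property of `rankinSelbergValueHeckeWt` when the value is uniquely determined.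
[cite: Nekovar1995, (0.5) p. 611 and §1.6–1.7] -/
theorem isRankinSelbergValueHeckeWt_rankinSelbergValueHeckeWt {g : CuspForm (Gamma0 M) k}
    {φ : HeckeCharacter K} {s₀ : ℂ} (h : ∃! L₀ : ℂ, IsRankinSelbergValueHeckeWt g φ s₀ L₀) :
    IsRankinSelbergValueHeckeWt g φ s₀ (rankinSelbergValueHeckeWt g φ s₀) := by
  rw [rankinSelbergValueHeckeWt, dif_pos h]
  exact h.choose_spec.1

/-- Two entire continuations of the weight-`k` Euler product coincide (identity theorem on the
half-plane `re s > (k+1)/2`). [cite: Nekovar1995, §1.6–1.7] -/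
theorem eq_of_isEntireContinuation_rankinSelbergHeckeWt {g : CuspForm (Gamma0 M) k}
    {φ : HeckeCharacter K} {L L₁ : ℂ → ℂ} (hL : Differentiable ℂ L)
    (hL' : ∀ s : ℂ, ((k : ℝ) + 1) / 2 < s.re → L s = rankinSelbergEulerProductHeckeWt g φ s)
    (hL₁ : Differentiable ℂ L₁)
    (hL₁' : ∀ s : ℂ, ((k : ℝ) + 1) / 2 < s.re → L₁ s = rankinSelbergEulerProductHeckeWt g φ s) :
    L₁ = L := by
  set z₀ : ℂ := (((((k : ℝ) + 1) / 2 + 1 : ℝ)) : ℂ) with hz₀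
  refine AnalyticOnNhd.eq_of_eventuallyEq (𝕜 := ℂ) (z₀ := z₀) (fun z _ ↦ hL₁.analyticAt z)
    (fun z _ ↦ hL.analyticAt z) ?_
  have hopen : IsOpen {s : ℂ | ((k : ℝ) + 1) / 2 < s.re} := isOpen_lt continuous_const Complex.continuous_re
  have hmem : ((k : ℝ) + 1) / 2 < z₀.re := by
    rw [hz₀, Complex.ofReal_re]
    linarith
  filter_upwards [hopen.mem_nhds hmem] with s hs
  rw [hL₁' s hs, hL' s hs]

/-- If an entire continuation `L` of the Euler product exists, `rankinSelbergValueHeckeWt` is its value.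
[cite: Nekovar1995, (0.5) p. 611 and §1.6–1.7] -/
theorem rankinSelbergValueHeckeWt_eq {g : CuspForm (Gamma0 M) k} {φ : HeckeCharacter K}
    {L : ℂ → ℂ} (hL : Differentiable ℂ L)
    (hL' : ∀ s : ℂ, ((k : ℝ) + 1) / 2 < s.re → L s = rankinSelbergEulerProductHeckeWt g φ s) (s₀ : ℂ) :
    rankinSelbergValueHeckeWt g φ s₀ = L s₀ := by
  have hex : ∃! L₀ : ℂ, IsRankinSelbergValueHeckeWt g φ s₀ L₀ := by
    refine ⟨L s₀, fun L₁ hL₁ hL₁' ↦ ?_, fun L₀ h ↦ (h L hL hL').symm⟩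
    rw [eq_of_isEntireContinuation_rankinSelbergHeckeWt hL hL' hL₁ hL₁']
  exact (isRankinSelbergValueHeckeWt_rankinSelbergValueHeckeWt hex L hL hL').symm

/-! #### Weight `2`: the objects of this section ARE the weight-`2` objects -/

/-- At weight `2` the local factor is the weight-`2` local factor (`ℓ^{2−1} = ℓ`).
[cite: Nekovar1995, (0.5) p. 611 and §3.4] -/
theorem rankinSelbergLocalFactorInvHeckeWt_two (f : CuspForm (Gamma0 N) 2) (φ : HeckeCharacter K)
    (v : HeightOneSpectrum (𝓞 K)) (s : ℂ) :
    rankinSelbergLocalFactorInvHeckeWt f φ v s = rankinSelbergLocalFactorInvHecke f φ v s := by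
  have h : ((2 : ℤ) - 1) = 1 := by norm_num
  simp only [rankinSelbergLocalFactorInvHeckeWt, rankinSelbergLocalFactorInvHecke, h, zpow_one]

/-- At weight `2` the Euler product is the weight-`2` Euler product. [cite: Nekovar1995, §3.4] -/
theorem rankinSelbergEulerProductHeckeWt_two (f : CuspForm (Gamma0 N) 2) (φ : HeckeCharacter K)
    (s : ℂ) : rankinSelbergEulerProductHeckeWt f φ s = rankinSelbergEulerProductHecke f φ s := by
  simp only [rankinSelbergEulerProductHeckeWt, rankinSelbergEulerProductHecke,
    rankinSelbergLocalFactorInvHeckeWt_two]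

/-- At weight `2` the value predicate is the weight-`2` predicate (`(2+1)/2 = 3/2`).
[cite: Nekovar1995, §1.6–1.7] -/
theorem isRankinSelbergValueHeckeWt_two_iff (f : CuspForm (Gamma0 N) 2) (φ : HeckeCharacter K)
    (s₀ L₀ : ℂ) : IsRankinSelbergValueHeckeWt f φ s₀ L₀ ↔ IsRankinSelbergValueHecke f φ s₀ L₀ := by
  have h : (((2 : ℤ) : ℝ) + 1) / 2 = 3 / 2 := by norm_num
  simp only [IsRankinSelbergValueHeckeWt, IsRankinSelbergValueHecke, h,
    rankinSelbergEulerProductHeckeWt_two]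

/-- At weight `2` the special value is the weight-`2` special value `rankinSelbergValueHecke`.
[cite: Castella2018, Thm. 3.1] -/
theorem rankinSelbergValueHeckeWt_two (f : CuspForm (Gamma0 N) 2) (φ : HeckeCharacter K) (s₀ : ℂ) :
    rankinSelbergValueHeckeWt f φ s₀ = rankinSelbergValueHecke f φ s₀ := by
  have h : IsRankinSelbergValueHeckeWt f φ s₀ = IsRankinSelbergValueHecke f φ s₀ :=
    funext fun L₀ ↦ propext (isRankinSelbergValueHeckeWt_two_iff f φ s₀ L₀)
  unfold rankinSelbergValueHeckeWt rankinSelbergValueHecke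
  rw [h]

end RankinSelbergHeckeWt

/-! ### §2. The interpolation value at weight `k` (Castella–Hsieh Prop. 3.8 in Castella's normalisation) -/

section InterpolationWt

variable {K : Type u} [Field K] [NumberField K] {M N : ℕ} {k : ℤ}

/-- **The complex part of the weight-`k` interpolation value** at an unramified anticyclotomic Hecke
character `φ` of infinity type `(−n, n)` with `n ≥ k/2` (Castella's normalisation of Castella–Hsieh 2018,
Prop. 3.8 with `2r = k`, `χ = ψφ`, `n = r + m`; see the module docstring):
`Γ(n − k/2 + 1) Γ(n + k/2) · (1 − a_p(g) p^{−k/2} φ(𝔭) + ε_p φ(𝔭)²)² · L(g/K, φ, k/2) / (π^{2n+1} · Ω_K^{4n})`,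
with `ε_p = p^{−1}` if `p ∤ M` and `ε_p = 0` otherwise, `a_p(g) = cuspCoeff g p`, `φ(𝔭) = heckeValueExtZero φ 𝔭`
at the distinguished prime `𝔭 ∣ p`, `L(g/K, φ, k/2) = rankinSelbergValueHeckeWt g φ (k/2)`, `Ω_K ∈ ℂ^×`
the complex CM period (a parameter), and `k/2 : ℤ` integer division (`= r` for `k = 2r`). The full value
is this times `Ω_p^{4n}` (`IsBDPLFunctionWt`). At `k = 2` it is the tree's `bdpInterpolationValue`
(`bdpInterpolationValueWt_two`). [cite: CastellaHsieh2018, §3.3 Prop. 3.8 (publ.; arXiv Prop. 3.6)]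
[cite: Castella2018, Thm. 3.1] -/
def bdpInterpolationValueWt (p : ℕ) (g : CuspForm (Gamma0 M) k) (𝔭 : HeightOneSpectrum (𝓞 K))
    (φ : HeckeCharacter K) (n : ℕ) (ΩK : ℂ) : ℂ :=
  let εp : ℂ := if p ∣ M then 0 else ((p : ℂ))⁻¹
  let φ𝔭 : ℂ := heckeValueExtZero φ 𝔭
  let r : ℤ := k / 2
  Complex.Gamma ((n : ℂ) - (r : ℂ) + 1) * Complex.Gamma ((n : ℂ) + (r : ℂ)) *
    (1 - cuspCoeff g p * ((p : ℂ) ^ r)⁻¹ * φ𝔭 + εp * φ𝔭 ^ 2) ^ 2 *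
    rankinSelbergValueHeckeWt g φ (r : ℂ) / ((Real.pi : ℂ) ^ (2 * n + 1) * ΩK ^ (4 * n))

/-- For `p ∣ M` the term `ε_p` vanishes and the multiplier is `(1 − a_p p^{−k/2} φ(𝔭))²` (weight `2`:
Castella 2018, proof of Thm. 3.1; at weight `k > 2` only `p ∤ M` is printed — recorded for completeness of
the reduction to weight `2`). [cite: Castella2018, Thm. 3.1 (proof)] -/
theorem bdpInterpolationValueWt_of_dvd {p : ℕ} (hpM : p ∣ M) (g : CuspForm (Gamma0 M) k)
    (𝔭 : HeightOneSpectrum (𝓞 K)) (φ : HeckeCharacter K) (n : ℕ) (ΩK : ℂ) :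
    bdpInterpolationValueWt p g 𝔭 φ n ΩK =
      Complex.Gamma ((n : ℂ) - ((k / 2 : ℤ) : ℂ) + 1) * Complex.Gamma ((n : ℂ) + ((k / 2 : ℤ) : ℂ)) *
        (1 - cuspCoeff g p * ((p : ℂ) ^ (k / 2))⁻¹ * heckeValueExtZero φ 𝔭) ^ 2 *
        rankinSelbergValueHeckeWt g φ ((k / 2 : ℤ) : ℂ) / ((Real.pi : ℂ) ^ (2 * n + 1) * ΩK ^ (4 * n)) := by
  simp [bdpInterpolationValueWt, hpM]

/-- **At weight `2` the interpolation value is Castella's** (`k/2 = 1`: `Γ(n − 1 + 1)Γ(n + 1) = Γ(n)Γ(n+1)`,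
`p^{−1}`, `L(f/K, φ, 1)`). [cite: Castella2018, Thm. 3.1] -/
theorem bdpInterpolationValueWt_two (p : ℕ) (f : CuspForm (Gamma0 N) 2) (𝔭 : HeightOneSpectrum (𝓞 K))
    (φ : HeckeCharacter K) (n : ℕ) (ΩK : ℂ) :
    bdpInterpolationValueWt p f 𝔭 φ n ΩK = bdpInterpolationValue p f 𝔭 φ n ΩK := by
  have hr : ((2 : ℤ) / 2) = 1 := by decide
  simp only [bdpInterpolationValueWt, bdpInterpolationValue, hr, Int.cast_one, sub_add_cancel, zpow_one,
    rankinSelbergValueHeckeWt_two]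

end InterpolationWt

/-! ### §3. The characterising predicate at weight `k` -/

section IsBDPLFunctionWt

variable {K : Type u} [Field K] [NumberField K] {M N : ℕ} {k : ℤ}
variable {p : ℕ} [Fact p.Prime]

/-- **The interpolation property of the anticyclotomic `p`-adic `L`-function of a weight-`k` cusp form
`g ∈ S_k(Γ₀(M))` in Castella's normalisation** (the weight-`k` twin of `IsBDPLFunction`; Castella–Hsieh
2018 Def. 3.7 / Prop. 3.8 at weight `2r = k`, twisted by `Tw_{ψ^{−1}}` as in Castella 2018 Thm. 3.1 and
Castella 2020, proof of Thm. 2.11): `L ∈ R₀⟦T⟧ = Λ_{R₀}` (`1 + T ↔ γ`) satisfies — for every Hecke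
character `φ` of `K` UNRAMIFIED at all finite places, of infinity type `(−n, n)` read as in the weight-`2`
frame (tree `HasInfinityType (fun _ ↦ n) (fun _ ↦ −n)`) with `n ≥ k/2` (the range `m = n − r ≥ 0` of
Prop. 3.8; integer division, `k = 2r`), and for every `p`-adic avatar `r` of `φ` factoring through `Γ` —
that the value of `L` at `T = φ̂(γ) − 1` is

  `ι⁻¹(Γ(n − k/2 + 1)Γ(n + k/2) · (1 − a_p(g) p^{−k/2} φ(𝔭) + ε_p φ(𝔭)²)² · L(g/K, φ, k/2) / (π^{2n+1} Ω_K^{4n})) · Ω_p^{4n}`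

(`bdpInterpolationValueWt` transported along `ι⁻¹ : ℂ → ℚ̄_p ⊂ ℂ_p`, times `Ω_p^{4n}`). Parameters as in
the weight-`2` frame: `ι : ℚ̄_p ≃ ℂ`, the distinguished prime `𝔭 ∣ p`, the anticyclotomic `ℤ_p`-extension
`κ` with topological generator `γ`, the form `g` (meant: a `p`-ordinary newform of even weight `k ≥ 2` and
level `M` with `p ∤ M`), the CM periods `Ω_K ∈ ℂ`, `Ω_p ∈ ℂ_p` (meant: `Ω_K ≠ 0`, `Ω_p ∈ R₀^×`). A
characterising PREDICATE, not a construction and not an existence claim. At `k = 2`: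
`isBDPLFunctionWt_two_iff`. Consumer: SPEC-19270-RoadFF facts F3 (Castella 2020 Thm. 2.11 ⇒
`(L_m) + (p^m) = (L_f) + (p^m)`) and F4 (erratum Thm. 2.3 / FW21 Thm. 4.41).
[cite: CastellaHsieh2018, §3.3 Def. 3.7 and Prop. 3.8 (publ.)] [cite: Castella2018, Thm. 3.1]
[cite: Castella2020JIMJ, Thm. 2.11 and Rem. 2.12] -/
def IsBDPLFunctionWt (ι : PadicAlgCl p ≃+* ℂ) (𝔭 : HeightOneSpectrum (𝓞 K)) (κ : ZpExtension K p)
    (γ : absoluteGaloisGroup K) (g : CuspForm (Gamma0 M) k) (ΩK : ℂ) (Ωp : ℂ_[p])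
    (L : UnrSeries p) : Prop :=
  ∀ (φ : HeckeCharacter K) (n : ℕ), k / 2 ≤ (n : ℤ) → (∀ v : HeightOneSpectrum (𝓞 K), φ.IsUnramifiedAt v) →
    φ.HasInfinityType (fun _ ↦ (n : ℤ)) (fun _ ↦ -(n : ℤ)) →
    ∀ r : FramedGaloisRep K (PadicAlgCl p) 1, IsPAdicAvatarOf ι φ r → FactorsThroughZp κ r →
      L.HasValueAt (avatarValueAt r γ - 1)
        (((ι.symm (bdpInterpolationValueWt p g 𝔭 φ n ΩK) : PadicAlgCl p) : ℂ_[p]) * Ωp ^ (4 * n))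

/-! #### API -/

variable {ι : PadicAlgCl p ≃+* ℂ} {𝔭 : HeightOneSpectrum (𝓞 K)} {κ : ZpExtension K p}
  {γ : absoluteGaloisGroup K} {g : CuspForm (Gamma0 M) k} {ΩK : ℂ} {Ωp : ℂ_[p]} {L : UnrSeries p}

/-- Unfolding `IsBDPLFunctionWt` at one character: the prescribed value at `T = φ̂(γ) − 1`.
[cite: CastellaHsieh2018, §3.3 Prop. 3.8 (publ.)] -/
theorem IsBDPLFunctionWt.hasValueAt (hL : IsBDPLFunctionWt ι 𝔭 κ γ g ΩK Ωp L) {φ : HeckeCharacter K}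
    {n : ℕ} (hn : k / 2 ≤ (n : ℤ)) (hunr : ∀ v : HeightOneSpectrum (𝓞 K), φ.IsUnramifiedAt v)
    (hinf : φ.HasInfinityType (fun _ ↦ (n : ℤ)) (fun _ ↦ -(n : ℤ)))
    {r : FramedGaloisRep K (PadicAlgCl p) 1} (hr : IsPAdicAvatarOf ι φ r)
    (hκ : FactorsThroughZp κ r) :
    L.HasValueAt (avatarValueAt r γ - 1)
      (((ι.symm (bdpInterpolationValueWt p g 𝔭 φ n ΩK) : PadicAlgCl p) : ℂ_[p]) * Ωp ^ (4 * n)) :=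
  hL φ n hn hunr hinf r hr hκ

/-- The prescribed value at a character in the range of interpolation is unique: any `v` with
`L.HasValueAt (φ̂(γ) − 1) v` is the weight-`k` right-hand side. [cite: CastellaHsieh2018, §3.3 Prop. 3.8 (publ.)] -/
theorem IsBDPLFunctionWt.eq_of_hasValueAt (hL : IsBDPLFunctionWt ι 𝔭 κ γ g ΩK Ωp L)
    {φ : HeckeCharacter K} {n : ℕ} (hn : k / 2 ≤ (n : ℤ))
    (hunr : ∀ v : HeightOneSpectrum (𝓞 K), φ.IsUnramifiedAt v)
    (hinf : φ.HasInfinityType (fun _ ↦ (n : ℤ)) (fun _ ↦ -(n : ℤ)))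
    {r : FramedGaloisRep K (PadicAlgCl p) 1} (hr : IsPAdicAvatarOf ι φ r)
    (hκ : FactorsThroughZp κ r) {v : ℂ_[p]} (hv : L.HasValueAt (avatarValueAt r γ - 1) v) :
    v = ((ι.symm (bdpInterpolationValueWt p g 𝔭 φ n ΩK) : PadicAlgCl p) : ℂ_[p]) * Ωp ^ (4 * n) :=
  hv.unique (hL.hasValueAt hn hunr hinf hr hκ)

/-! #### Weight `2`: `IsBDPLFunctionWt` IS `IsBDPLFunction` -/

/-- **At weight `2` the frame is the tree's weight-`2` frame**: for `f ∈ S₂(Γ₀(N))`,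
`IsBDPLFunctionWt ι 𝔭 κ γ f ΩK Ωp L ↔ IsBDPLFunction ι 𝔭 κ γ f ΩK Ωp L` (range `2/2 ≤ n ↔ 0 < n`, value
`bdpInterpolationValueWt_two`). [cite: Castella2018, Thm. 3.1] -/
theorem isBDPLFunctionWt_two_iff (f : CuspForm (Gamma0 N) 2) :
    IsBDPLFunctionWt ι 𝔭 κ γ f ΩK Ωp L ↔ IsBDPLFunction ι 𝔭 κ γ f ΩK Ωp L := by
  have hr : ((2 : ℤ) / 2) = 1 := by decide
  have hiff : ∀ n : ℕ, ((2 : ℤ) / 2 ≤ (n : ℤ)) ↔ 0 < n := fun n ↦ by rw [hr]; omega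
  simp only [IsBDPLFunctionWt, IsBDPLFunction, hiff, bdpInterpolationValueWt_two]

/-- A weight-`2` frame is a weight-`k = 2` frame. [cite: Castella2018, Thm. 3.1] -/
theorem IsBDPLFunction.isBDPLFunctionWt {f : CuspForm (Gamma0 N) 2} (h : IsBDPLFunction ι 𝔭 κ γ f ΩK Ωp L) :
    IsBDPLFunctionWt ι 𝔭 κ γ f ΩK Ωp L :=
  (isBDPLFunctionWt_two_iff f).2 h

/-- A weight-`k = 2` frame is a weight-`2` frame. [cite: Castella2018, Thm. 3.1] -/
theorem IsBDPLFunctionWt.isBDPLFunction {f : CuspForm (Gamma0 N) 2} (h : IsBDPLFunctionWt ι 𝔭 κ γ f ΩK Ωp L) :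
    IsBDPLFunction ι 𝔭 κ γ f ΩK Ωp L :=
  (isBDPLFunctionWt_two_iff f).1 h

end IsBDPLFunctionWt

end Literature.NumberTheory.EllipticCurves

end
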